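import Summits.QuantumFields.YangMills.Theorems.LuscherReductionTwistedTraceScalingOnionRefinedGlue
import HarnessLib

/-!
# Refined-onion admissibility up to `q < 8/9`: the VALLEY may sit at `η = β^{−q}` with `q` close to `1`
# (lane A of S-BASE, crux `TwistedTraceScaling` stmt-QuantumFields-20203; design note `pub/ym-fleet/ym-luscher-20007-p1/COARSE-DESIGN.md` §15–§16)

`scalesAdmissible₂_powScale` (`…OnionRefined`) used `e^{−x} ≤ 1/x` and reached `q < 2/3`.  With `e^{−x} ≤ 6/x³` (`Real.pow_div_factorial_le_exp`) the two Boltzmann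
terms of `onionErr₂` at `η = β^{−q}` are `≤ (6 + 6π²)·β^{−3(1−q)}`, negligible against `λ_b ≍ β^{−1/3}` as soon as `q < 8/9`:
★ `scalesAdmissible₂_powScale₉ : 0 < p < 1/3 → q < 8/9 → ScalesAdmissible₂ L (β^{−p}) (β^{−q})`, and the glue corollaries
★★ `coarseNoIntruderAt_of_valley_oneOrbit_pow₉` / `coarseNoIntruderAt_of_kernelRow_pow₉` (COARSE-UPPER(L) ⇐ `ValleyKernelRowBoundAt L (β^{−p}) (β^{−q})` +
`InnerNoIntruderOneOrbitAt L (β^{−p})`, `0 < p < 1/3`, `q < 8/9`).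
WHY (design §16): at a valley point the Born–Oppenheimer weight can be as small as `exp(−O(β^{1−q+p}))` (soft charged modes excited to action `η`), so the near/far chart
radius `ρ` of the step analysis must satisfy `βρ² ≳ β^{1−q+p}` while the cubic remainder needs `βρ³ → 0`: possible iff `q − p > 2/3`, i.e. `q` close to `1`.
HONEST FRAMING: bookkeeping for a stub lane of a child of the CONDITIONAL reduction route (femto rung R2b1); not a gap, not Clay.
-/

set_option autoImplicit false

noncomputable section

open MeasureTheory Filter Topology Real
open scoped BigOperators
open Literature.MathematicalPhysics.QuantumFieldTheory
open Literature.MathematicalPhysics.QuantumLattice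

namespace Summit.QuantumFields.YangMills.Theorems.FemtoTransferGap

variable {L : ℕ} [NeZero L]

/-- The two Boltzmann terms of `onionErr₂` at `η = β^{−q}`, cubic decay: `e^{−βη} + (π²/8)e^{−βη/2} ≤ (6 + 6π²)·β^{−(8/3 − 3q)}·β^{−1/3}` (`β ≥ 1`). [folklore] -/
theorem boltzmann_terms_le₉ {β q : ℝ} (hβ : 1 ≤ β) :
    Real.exp (-(β * powScale q β)) + π ^ 2 / 8 * Real.exp (-(β * powScale q β / 2)) ≤
      (6 + 6 * π ^ 2) * (β ^ (-(8 / 3 - 3 * q)) * β ^ (-(1 : ℝ) / 3)) := by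
  have hβ0 : 0 < β := by linarith
  rw [powScale_eq hβ]
  have hx : β * β ^ (-q) = β ^ (1 - q) := by rw [sub_eq_add_neg, Real.rpow_add hβ0, Real.rpow_one]
  have hxpos : 0 < β ^ (1 - q) := Real.rpow_pos_of_pos hβ0 _
  have hcube : 1 / (β ^ (1 - q)) ^ 3 = β ^ (-(8 / 3 - 3 * q)) * β ^ (-(1 : ℝ) / 3) := by
    rw [one_div, ← Real.rpow_natCast, ← Real.rpow_mul hβ0.le, ← Real.rpow_neg hβ0.le, ← Real.rpow_add hβ0]
    congr 1; push_cast; ring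
  rw [hx]
  -- `e^{−x} ≤ 6/x³` for `x > 0` (from `x³/3! ≤ eˣ`)
  have hexp : ∀ x : ℝ, 0 < x → Real.exp (-x) ≤ 6 / x ^ 3 := fun x hx0 => by
    have h := Real.pow_div_factorial_le_exp x hx0.le 3
    have h3 : ((Nat.factorial 3 : ℕ) : ℝ) = 6 := by norm_num [Nat.factorial]
    rw [h3] at h
    rw [Real.exp_neg, le_div_iff₀ (by positivity)]
    rw [div_le_iff₀ (by norm_num : (0:ℝ) < 6)] at h
    calc (Real.exp x)⁻¹ * x ^ 3 = x ^ 3 / Real.exp x := by rw [inv_mul_eq_div]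
      _ ≤ 6 := by rw [div_le_iff₀ (Real.exp_pos x)]; linarith
  have h1 : Real.exp (-(β ^ (1 - q))) ≤ 6 * (1 / (β ^ (1 - q)) ^ 3) := by
    have := hexp _ hxpos; rw [mul_one_div]; exact this
  have h2 : Real.exp (-(β ^ (1 - q) / 2)) ≤ 48 * (1 / (β ^ (1 - q)) ^ 3) := by
    have := hexp _ (half_pos hxpos)
    refine this.trans (le_of_eq ?_)
    field_simp
    ring
  rw [← hcube]
  have h0 : 0 ≤ 1 / (β ^ (1 - q)) ^ 3 := by positivity
  nlinarith [h1, h2, h0, Real.pi_pos, sq_nonneg π]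

/-- ★ **Admissibility up to `q < 8/9`**: `ScalesAdmissible₂ L (β^{−p}) (β^{−q})` for `0 < p < 1/3` and `q < 8/9`. [cite: SimonB1983DiscreteSpectrum, §3] -/
theorem scalesAdmissible₂_powScale₉ {p q : ℝ} (hp0 : 0 < p) (hp : p < 1 / 3) (hq : q < 8 / 9) :
    ScalesAdmissible₂ L (powScale p) (powScale q) := by
  refine ⟨fun β => powScale_pos p β, fun β => powScale_pos q β, fun κ hκ => ?_⟩
  have hL : (0 : ℝ) < (L : ℝ) ^ 3 := by
    have : (0 : ℝ) < L := by exact_mod_cast Nat.pos_of_ne_zero (NeZero.ne L)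
    positivity
  have hcL := uniformFloorConst_pos (L := L)
  obtain ⟨-, -, hold⟩ := scalesAdmissible_powScale (L := L) hp0 hp
  obtain ⟨β1, hβ1⟩ := hold (κ / 2) (half_pos hκ)
  set κ' : ℝ := κ / 2 * (2 / (L : ℝ) ^ 3) ^ ((1 : ℝ) / 3) * uniformFloorConst L with hκ'
  have hκ'0 : 0 < κ' := by rw [hκ']; positivity
  have hq1 : 0 < 8 / 3 - 3 * q := by linarith
  obtain ⟨β2, hβ2⟩ := rpow_neg_eventually_le hq1 (M := κ' / (6 + 6 * π ^ 2)) (by positivity)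
  refine ⟨max β1 β2, fun β hβ => ?_⟩
  have hb1 : β1 ≤ β := (le_max_left _ _).trans hβ
  obtain ⟨hβone, hB⟩ := hβ2 β ((le_max_right _ _).trans hβ)
  have hβ0 : 0 < β := by linarith
  have hδ := (onionErr₂_delta_le_onionErr (L := L) hβ0 (powScale p β) (powScale p β)).trans (hβ1 β hb1)
  have hBz := boltzmann_terms_le₉ (q := q) hβone
  have hb3 : 0 < β ^ (-(1 : ℝ) / 3) := Real.rpow_pos_of_pos hβ0 _
  have hBz' : Real.exp (-(β * powScale q β)) + π ^ 2 / 8 * Real.exp (-(β * powScale q β / 2)) ≤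
      κ / 2 * bareLambda ((L : ℝ) ^ 3 * β) * uniformFloorConst L := by
    rw [bareLambda_cube_eq (L := L) hβ0]
    refine hBz.trans ?_
    have h1 : (6 + 6 * π ^ 2) * (β ^ (-(8 / 3 - 3 * q)) * β ^ (-(1 : ℝ) / 3)) ≤ (6 + 6 * π ^ 2) * (κ' / (6 + 6 * π ^ 2) * β ^ (-(1 : ℝ) / 3)) :=
      mul_le_mul_of_nonneg_left (mul_le_mul_of_nonneg_right hB hb3.le) (by positivity)
    refine h1.trans (le_of_eq ?_)
    rw [hκ']; field_simp
  unfold onionErr₂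
  linarith [hδ, hBz']

/-- ★★ **COARSE-UPPER(L) at `(δ, η) = (β^{−p}, β^{−q})`, `0 < p < 1/3`, `q < 8/9`**, from `ValleyGainAt` and the one-orbit INNER NO-INTRUDER.
[cite: Luscher1983, §3] [cite: LuscherMunster1984, §2] -/
theorem coarseNoIntruderAt_of_valley_oneOrbit_pow₉ {p q : ℝ} (hp0 : 0 < p) (hp : p < 1 / 3) (hq : q < 8 / 9)
    (hV : ValleyGainAt L (powScale p) (powScale q)) (hI : InnerNoIntruderOneOrbitAt L (powScale p)) :
    ∀ k : ℕ, ∀ d : ℝ, d < levelGap k → ∃ lam0 : ℝ, 0 < lam0 ∧ ∀ lam : ℝ, 0 < lam → lam ≤ lam0 →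
      ∀ β : ℝ, InFemtoWindow lam β L →
        levelValue su2Rep L β k ≤ Real.exp (-(d * luscherLambda β L) / L) * levelValue su2Rep L β 0 := by
  have hL : (0 : ℝ) < L := by exact_mod_cast Nat.pos_of_ne_zero (NeZero.ne L)
  exact coarseNoIntruderAt_of_valley_inner₂ (scalesAdmissible₂_powScale₉ hp0 hp hq) hV
    (innerNoIntruderAt_of_oneOrbit (fun β => powScale_pos p β) (powScale_eventually_le hp0 (by positivity)) hI)

/-- ★★ **COARSE-UPPER(L) from the covariant VALLEY KERNEL ROW BOUND and INNER NO-INTRUDER (one orbit) at `(β^{−p}, β^{−q})`, `0 < p < 1/3`, `q < 8/9`.**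
[cite: Luscher1983, §3] [cite: LuscherMunster1984, §2] -/
theorem coarseNoIntruderAt_of_kernelRow_pow₉ {p q : ℝ} (hp0 : 0 < p) (hp : p < 1 / 3) (hq : q < 8 / 9)
    (hV : ValleyKernelRowBoundAt L (powScale p) (powScale q)) (hI : InnerNoIntruderOneOrbitAt L (powScale p)) :
    ∀ k : ℕ, ∀ d : ℝ, d < levelGap k → ∃ lam0 : ℝ, 0 < lam0 ∧ ∀ lam : ℝ, 0 < lam → lam ≤ lam0 →
      ∀ β : ℝ, InFemtoWindow lam β L →
        levelValue su2Rep L β k ≤ Real.exp (-(d * luscherLambda β L) / L) * levelValue su2Rep L β 0 :=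
  coarseNoIntruderAt_of_valley_oneOrbit_pow₉ hp0 hp hq (valleyGainAt_of_kernelRowBound hV) hI

end Summit.QuantumFields.YangMills.Theorems.FemtoTransferGap

end
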